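import Summits.HubbardSuperconductivity.HubbardLadder.EDSectorGlue
import Summits.HubbardSuperconductivity.HubbardLadder.R3R4Sound
import Summits.HubbardSuperconductivity.HubbardLadder.R3R4SumRule
import HarnessLib

/-!
# Rung R3 — the E-D-2″ calibration row at `L = 4`, assembled: the complete obligation list in one type

HONEST FRAMING: ladder R1–R4 with certified numbers; no claim on H/H₀.

This file composes theorems already in the tree (`EDSectorBlockCert.complement` — T7.3, `EDSectorGlue`;
`ResidualComplementMultipletData.ofOrthogonal`, `value_range_of_form_bounds`, `….toWindow` — `R3R4Sound*`;
`FiniteDichotomyCert.ofWindows`, `R3DichotomyU8Eighth` — `R3R4Props` / `R3R4SumRule`) into ONE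
producer-facing statement. `EDRowFacts L H N r` is the CHECKLIST of what the exact-arithmetic campaign
(cell `pub-hubbard-r3/EFFICIENCY-ED2p.md`, `R3-DESIGN.md` §8–§11; post-numerics-gate, EXACT class,
lead-named — NOT run) must deliver for one Hamiltonian `H` on the `L × L` torus in the sector
`(N, S^z = 0)` at displacement `r`:

* an orthogonal family `v : Fin m → Fock` of explicit (rational) approximate ground vectors in the sector,
  with squared norms `s i > 0`, a Rayleigh bound `Re⟨v_{i₀}, H v_{i₀}⟩ ≤ ρ s_{i₀}`, residual bounds
  `‖H v_i − σ_i v_i‖² ≤ ε² s_i`, two quadratic-form bounds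
  `gm Σ|b_i|² s_i ≤ P̄_d(L, r; Σ b_i v_i) ≤ gp Σ|b_i|² s_i` (two `m × m` matrix inequalities);
* a complement level `β > ρ` together with an `EDSectorBlockCert L H N β v B F P` (block-ordered real
  frame spanning the sector, exact block-local constraint vectors `c_j = Φᴴ v_j`, and ONE certified form
  inequality per symmetry block — each produced from one exact PSD fact by `blk_of_pencil_chebyshev_cert` /
  `blk_of_residual_cert` of `EDBlockGlue`).

From these, `EDRowFacts.toWindowAt` is a `PairCorrWindowCert` row with the EXPLICIT ends
`lo = min (gm t₀) gm − C_d² (2δ + δ²)`, `hi = max gp (gp t₀) + C_d² (2δ + δ²)`, `δ = m ε / (β − ρ)`,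
`t₀ = 1 − δ²` (fields `EDRowFacts.lo` / `.hi`; `PairCorrWindowCert.lo (toWindowAt …) = f.lo` by `rfl`), and
two rows — `H = hubbardTorusTT' 4 1 0 8` (= `pureHubbard 8 4`, `hubbardTorusTT'_zero`) and
`H = hubbardTorusTT' 4 1 (-1/4) 8`, both at `N = electronNumber (1/8) 4 = 14` — with `max |lo⁰| |hi⁰| < lo⁻`
give a term of `R3DichotomyU8Eighth 4 r` (`r3DichotomyFour_of_rowFacts`),
i.e. the result line "certified: at L = 4, r, P_d^{t'=0}(r) ≤ a < b ≤ P_d^{t'=-1/4}(r)" with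
`a = max |lo⁰| |hi⁰|`, `b = lo⁻`. If that strict inequality fails for the numbers the campaign certifies,
the result line is "brackets overlap: no dichotomy certified at this size".

RESULT LINE (iii) AS OF THIS FILE: no R3 instance has been run; no `EDRowFacts` term exists for any
`(t', r)`; no dichotomy is certified at any size; there are no brackets to overlap. The intended rows are the
calibration rows `L = 4`, `(N↑, N↓) = (7, 7)`, `U = 8`, `t' ∈ {0, −1/4}`, `r ∈ {(2,0), (2,1), (2,2)}`
("short distance, |r| ≤ 2√2; shell-effect caveat" — `R3-DESIGN.md` §9, §11).
-/

namespace Summit.HubbardSuperconductivity.HubbardLadder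

open Matrix Finset Literature.Probability.LatticeModels Literature.MathematicalPhysics.QuantumLattice
open scoped ComplexOrder

noncomputable section

/-! ## §1 Two bookkeeping identities at the headline instance -/

/-- `electronNumber (1/8) 4 = 2⌊(7/8)·16/2⌋ = 14` (the `(7,7)` sector). [folklore] -/
theorem electronNumber_eighth_four : electronNumber (1 / 8) 4 = 14 := by
  have h : (1 - 1 / 8 : ℝ) * (4 : ℕ) ^ 2 / 2 = (7 : ℕ) := by norm_num
  rw [electronNumber, h, Nat.floor_natCast]

/-- The pure model at `L = 4`, `U = 8` is the `t' = 0` member of the `t–t'` family. [folklore] -/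
theorem pureHubbard_eight_four : pureHubbard 8 4 = hubbardTorusTT' 4 1 0 8 := by
  rw [pureHubbard, hubbardTorusTT'_zero]

/-! ## §2 The producer's checklist for one row -/

/-- **E-D-2″ row facts** for the Hamiltonian `H` on the `L × L` torus, sector `(N, S^z = 0)`,
displacement `r`: everything the exact-arithmetic campaign must deliver for ONE `PairCorrWindowCert` row
(see the module docstring). All inequalities are between real (in practice rational) numbers once `H`,
`v`, `σ` are rational; `cert` packages the frame identities and the per-block certified form
inequalities (`EDSectorGlue`, `EDBlockGlue`). [folklore] -/
structure EDRowFacts (L : ℕ) [NeZero L]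
    (H : Matrix (Finset (Orb (FermionTorus 2 L))) (Finset (Orb (FermionTorus 2 L))) ℂ) (N : ℕ)
    (r : Site 2) where
  /-- size of the approximate ground multiplet -/
  m : ℕ
  /-- the explicit, pairwise orthogonal (not normalised) approximate ground vectors -/
  v : Fin m → Fock (Orb (FermionTorus 2 L))
  /-- residual shifts -/
  σ : Fin m → ℂ
  /-- squared norms `s i = ⟨v i, v i⟩` -/
  s : Fin m → ℝ
  /-- Rayleigh (ground-energy) upper bound, per unit norm -/
  ρ : ℝ
  /-- common residual bound, per unit norm -/
  ε : ℝ
  /-- complement Rayleigh lower bound -/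
  β : ℝ
  /-- lower / upper quadratic-form bounds of `P̄_d(L, r; ·)` on the span, per unit norm -/
  gm : ℝ
  gp : ℝ
  /-- the member whose Rayleigh quotient is certified -/
  i₀ : Fin m
  /-- symmetry blocks and the free / pinned column index types of the block-ordered frame -/
  B : Type
  [fintypeB : Fintype B]
  [decEqB : DecidableEq B]
  F : B → Type
  P : B → Type
  [fintypeF : ∀ b, Fintype (F b)]
  [fintypeP : ∀ b, Fintype (P b)]
  /-- the E-D-2″ sector certificate at level `β` for the multiplet `v` (T7.3 data) -/
  cert : EDSectorBlockCert L H N β v B F P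
  herm : H.IsHermitian
  mem : ∀ i, v i ∈ szSector (Λ := FermionTorus 2 L) N 0
  horth : ∀ i j, star (v i) ⬝ᵥ v j = if i = j then ((s i : ℝ) : ℂ) else 0
  hs0 : ∀ i, 0 < s i
  rayleigh_le : (star (v i₀) ⬝ᵥ H *ᵥ v i₀).re ≤ ρ * s i₀
  hε : 0 ≤ ε
  residual_sq_le : ∀ i, eucNorm (H *ᵥ v i - σ i • v i) ^ 2 ≤ ε ^ 2 * s i
  gap : ρ < β
  form_bounds : ∀ b : Fin m → ℂ,
    gm * (∑ i, ‖b i‖ ^ 2 * s i) ≤ avgPairCorr L r (∑ i, b i • v i) ∧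
      avgPairCorr L r (∑ i, b i • v i) ≤ gp * (∑ i, ‖b i‖ ^ 2 * s i)

attribute [instance] EDRowFacts.fintypeB EDRowFacts.decEqB EDRowFacts.fintypeF EDRowFacts.fintypeP

namespace EDRowFacts

variable {L : ℕ} [NeZero L]
  {Hm : Matrix (Finset (Orb (FermionTorus 2 L))) (Finset (Orb (FermionTorus 2 L))) ℂ} {N₀ : ℕ}
  {r : Site 2}

/-- The span-enclosure radius `δ = m ε / (β − ρ)`. [folklore] -/
def δ (f : EDRowFacts L Hm N₀ r) : ℝ := f.m * f.ε / (f.β - f.ρ)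

/-- The inner radius `t₀ = 1 − δ²` of the near-unit shell of the span. [folklore] -/
def t₀ (f : EDRowFacts L Hm N₀ r) : ℝ := 1 - f.δ ^ 2

/-- The correlator slack `C_d² (2δ + δ²)`. [folklore] -/
def slack (f : EDRowFacts L Hm N₀ r) : ℝ := dWaveLocalPairNormConst ^ 2 * (2 * f.δ + f.δ ^ 2)

/-- **The certified lower end of the row**, explicitly: `min (gm t₀) gm − C_d² (2δ + δ²)`. [folklore] -/
def lo (f : EDRowFacts L Hm N₀ r) : ℝ := min (f.gm * f.t₀) f.gm - f.slack

/-- **The certified upper end of the row**, explicitly: `max gp (gp t₀) + C_d² (2δ + δ²)`. [folklore] -/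
def hi (f : EDRowFacts L Hm N₀ r) : ℝ := max f.gp (f.gp * f.t₀) + f.slack

/-- The §5 multiplet certificate of `R3R4SoundMultiplet` from row facts stated over the family members
`H L`, `N L` (`ofOrthogonal` with `complement := cert.complement` and the span enclosure from
`value_range_of_form_bounds`). [folklore] -/
def multipletData {H : TorusHamiltonianFamily} {N : ℕ → ℕ} (f : EDRowFacts L (H L) (N L) r) :
    ResidualComplementMultipletData H N L r :=
  ResidualComplementMultipletData.ofOrthogonal (H := H) (N := N) f.v f.σ f.s f.ρ f.ε f.β
    (min (f.gm * (1 - (f.m * f.ε / (f.β - f.ρ)) ^ 2)) f.gm)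
    (max f.gp (f.gp * (1 - (f.m * f.ε / (f.β - f.ρ)) ^ 2))) f.i₀ f.herm f.mem f.horth f.hs0
    f.rayleigh_le f.hε f.residual_sq_le f.gap f.cert.complement
    (value_range_of_form_bounds f.horth f.form_bounds)

/-- The multiplet certificate's window ends are the explicit `lo` / `hi`. [folklore] -/
theorem multipletData_lo {H : TorusHamiltonianFamily} {N : ℕ → ℕ} (f : EDRowFacts L (H L) (N L) r) :
    f.multipletData.glo - f.multipletData.slack = f.lo := rfl

/-- The multiplet certificate's upper window end is the explicit `hi`. [folklore] -/
theorem multipletData_hi {H : TorusHamiltonianFamily} {N : ℕ → ℕ} (f : EDRowFacts L (H L) (N L) r) :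
    f.multipletData.ghi + f.multipletData.slack = f.hi := rfl

/-- **Soundness of one row over a family.** Row facts for the concrete matrix `Hm` and sector label
`N₀` bound the correlator of every normalised sector ground state of any family member `H L = Hm`,
`N L = N₀` by the explicit ends `f.lo`, `f.hi`. [folklore] -/
theorem window (f : EDRowFacts L Hm N₀ r) {H : TorusHamiltonianFamily} {N : ℕ → ℕ} (hH : H L = Hm)
    (hN : N L = N₀) :
    ∀ ψ : Fock (Orb (FermionTorus 2 L)), star ψ ⬝ᵥ ψ = 1 → IsGroundStateInSector (H L) (N L) 0 ψ →
      f.lo ≤ avgPairCorr L r ψ ∧ avgPairCorr L r ψ ≤ f.hi := by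
  subst hH hN
  intro ψ hψ hgs
  rw [← f.multipletData_lo, ← f.multipletData_hi]
  exact f.multipletData.window ψ hψ hgs

/-- **One row, assembled.** Row facts for the concrete matrix `Hm` and sector label `N₀` give the
`PairCorrWindowCert` row of any family `(H, N)` with `H L = Hm`, `N L = N₀`, with the explicit ends
`f.lo`, `f.hi` (definitionally). [folklore] -/
def toWindowAt (f : EDRowFacts L Hm N₀ r) {H : TorusHamiltonianFamily} {N : ℕ → ℕ} (hH : H L = Hm)
    (hN : N L = N₀) : PairCorrWindowCert H N L r where
  lo := f.lo
  hi := f.hi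
  sound := f.window hH hN

end EDRowFacts

/-! ## §3 The two calibration rows at `L = 4`, `(U, δ) = (8, 1/8)` and the R3 object -/

/-- The `t–t'` row at `L = 4`: facts for `hubbardTorusTT' 4 1 t' 8` in the sector `N = 14` give the
window of the family `L ↦ hubbardTorusTT' L 1 t' 8` at `electronNumber (1/8)`. [folklore] -/
def calibrationWindowTT' (t' : ℝ) (r : Site 2) (f : EDRowFacts 4 (hubbardTorusTT' 4 1 t' 8) 14 r) :
    PairCorrWindowCert (fun L => hubbardTorusTT' L 1 t' 8) (electronNumber (1 / 8)) 4 r :=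
  f.toWindowAt rfl electronNumber_eighth_four

/-- The `t' = 0` row read as a row of the PURE model `pureHubbard 8` (`hubbardTorusTT'_zero`). [folklore] -/
def calibrationWindowPure (r : Site 2) (f : EDRowFacts 4 (hubbardTorusTT' 4 1 0 8) 14 r) :
    PairCorrWindowCert (pureHubbard 8) (electronNumber (1 / 8)) 4 r :=
  f.toWindowAt pureHubbard_eight_four electronNumber_eighth_four

/-- **R3 at `L = 4`, assembled from two rows.** Row facts at `t' = 0` and at `t' = −1/4` (both `U = 8`,
sector `(7,7)`) whose explicit windows do not overlap, `max |lo⁰| |hi⁰| < lo⁻`, give the finite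
dichotomy object `R3DichotomyU8Eighth 4 r` with `a = max |lo⁰| |hi⁰|`, `b = lo⁻`. [folklore] -/
def r3DichotomyFour_of_rowFacts (r : Site 2) (f₀ : EDRowFacts 4 (hubbardTorusTT' 4 1 0 8) 14 r)
    (f₁ : EDRowFacts 4 (hubbardTorusTT' 4 1 (-1 / 4) 8) 14 r) (h : max |f₀.lo| |f₀.hi| < f₁.lo) :
    R3DichotomyU8Eighth 4 r :=
  FiniteDichotomyCert.ofWindows (calibrationWindowPure r f₀) (calibrationWindowTT' (-1 / 4) r f₁) h

/-- The assembled dichotomy certificate's lower level `a` is `max |f₀.lo| |f₀.hi|`. [folklore] -/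
theorem r3DichotomyFour_of_rowFacts_a (r : Site 2) (f₀ : EDRowFacts 4 (hubbardTorusTT' 4 1 0 8) 14 r)
    (f₁ : EDRowFacts 4 (hubbardTorusTT' 4 1 (-1 / 4) 8) 14 r) (h : max |f₀.lo| |f₀.hi| < f₁.lo) :
    (r3DichotomyFour_of_rowFacts r f₀ f₁ h).a = max |f₀.lo| |f₀.hi| := rfl

/-- The assembled dichotomy certificate's upper level `b` is `f₁.lo`. [folklore] -/
theorem r3DichotomyFour_of_rowFacts_b (r : Site 2) (f₀ : EDRowFacts 4 (hubbardTorusTT' 4 1 0 8) 14 r)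
    (f₁ : EDRowFacts 4 (hubbardTorusTT' 4 1 (-1 / 4) 8) 14 r) (h : max |f₀.lo| |f₀.hi| < f₁.lo) :
    (r3DichotomyFour_of_rowFacts r f₀ f₁ h).b = f₁.lo := rfl

/-! ## §4 Typed obligation and its proof -/

/-- **Typed obligation (assembly of the R3 calibration row at `L = 4`)**: two E-D-2″ row-fact bundles,
for `hubbardTorusTT' 4 1 0 8` and `hubbardTorusTT' 4 1 (-1/4) 8` in the sector `N = 14`, whose explicit
windows satisfy `max |lo⁰| |hi⁰| < lo⁻`, yield the R3 dichotomy object at `(4, r)` with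
`a = max |lo⁰| |hi⁰|`, `b = lo⁻`. PROVED (`edCalibrationRowAssembly_holds`); NO such bundle exists
(nothing has been run). The hypotheses of `EDRowFacts` are the complete list of what the campaign must
certify. -/
@[conjecture] def EDCalibrationRowAssembly : Prop :=
  ∀ (r : Site 2) (f₀ : EDRowFacts 4 (hubbardTorusTT' 4 1 0 8) 14 r)
    (f₁ : EDRowFacts 4 (hubbardTorusTT' 4 1 (-1 / 4) 8) 14 r),
    max |f₀.lo| |f₀.hi| < f₁.lo →
      ∃ c : R3DichotomyU8Eighth 4 r, c.a = max |f₀.lo| |f₀.hi| ∧ c.b = f₁.lo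

/-- **Proof of `EDCalibrationRowAssembly`.** -/
theorem edCalibrationRowAssembly_holds : EDCalibrationRowAssembly :=
  fun r f₀ f₁ h => ⟨r3DichotomyFour_of_rowFacts r f₀ f₁ h, r3DichotomyFour_of_rowFacts_a r f₀ f₁ h,
    r3DichotomyFour_of_rowFacts_b r f₀ f₁ h⟩

end

end Summit.HubbardSuperconductivity.HubbardLadder
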